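import Summits.QuantumFields.BalabanUV.Beta.EriceFlowEnclosureB12AsPrintedHistoryContagionShiftFlowZeroSemigroupCanonical
import Summits.QuantumFields.BalabanUV.Beta.EriceFlowEnclosureB12AsPrintedHistoryContagionShiftFlowZeroIsometryTwoLoop
import Summits.QuantumFields.BalabanUV.Beta.EriceFlowEnclosureB12AsPrintedHistoryContagionShiftFlowZeroEnd

/-!
# Beta / EriceFlowEnclosureB12AsPrintedHistoryContagionShiftFlowZeroSemigroupEnd — ASYMPTOTIC FREEDOM IS CONTAGIOUS, part 50: THEOREM 2 AS TYPED ⟹ THE CONTINUUM RUNNING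
# COUPLING OF [I]'s «g₀(ε, g)» HAS A PRINCIPAL Λ-COORDINATE AND EMBEDS IN A CANONICAL CONTINUOUS RENORMALIZATION GROUP.  The carrier ENDs of parts 44–49 on the AS-PRINTED
# interface: `Theorem2Statement S hL` (a HYPOTHESIS — [I] Theorem 2, p. 259, STATED WITHOUT PROOF), `hrg` on ]0, γ_u], NE4 `ScaleShiftRate c θ γ_u S.β`, the moduli
# `HistLipschitz Λ γ_u S.β` ∕ `FadingMemory C θ Λ` (0 < θ < 1).  THEN (§77), with β₀ > 0 THE value of `betaInf S.β` at the zero history and, for every torus exponent m, ONE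
# threshold g₂₅ > 0: for EVERY reference coupling `g′ ≤ g₂₅` carrying a Theorem-2-type family `rows′`, the Λ-function Λf of part 36 (`1∕gstar rows n² − 1∕gstar rows′ n² →
# Λf g` for every family pinned at `g ≤ g′`, Abel equation `Λf(gstar rows k) = Λf g + kβ₀`) is **ASYMPTOTICALLY CHART-ISOMETRIC** `|(Λf g − Λf g̃) − (1∕g² − 1∕g̃²)| ≤
# κ·g̃·(1∕g² − 1∕g̃²)`, `κ = 64C∕(3(1−θ)b)`, obeys **ONE-LOOP ASYMPTOTIC SCALING** `|Λf g − (1∕g² − 1∕g′²)| ≤ (8C∕((1−θ)b))∕g + κg′(β₀ + Cγ_u∕(1−θ))`, `g²·Λf g → 1`, and is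
# **THE PRINCIPAL ABEL FUNCTION**: every Abel function of the limit flow near zero pin with Lévy's criterion equals `Λf + const` (`lambdaPrincipal_of_typedTheorem2`); and
# (**`continuousRG_of_typedTheorem2`**) there is a ONE-PARAMETER SEMIGROUP `φ` on ]0, g′] — `φ 0 = id`, `φ (s+s′) = φ s ∘ φ s′`, each `φ s` strictly increasing, `s ↦ φ s g`
# strictly decreasing to 0 — whose INTEGER TIMES ARE THE CONTINUUM TRAJECTORIES OF [I] THEOREM 2: **`φ k g = gstar rows k`** for every family `rows` pinned at `g ≤ g′` and
# every physical scale k (so `φ 1` is the continuum renormalization step of the limit theory and `φ (1∕2)` HALF A STEP), with chart rates `(3∕4)β₀ ≤ Δ(1∕φ²)∕Δs ≤ (3∕2)β₀`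
# and THE CONTINUOUS CLOCK **`s·β₀·(φ s g)² → 1`**; by part 47 it is canonical.  Under a two-loop coordinate of the limit flow (part 41 supplies one under (T2m)):
# **`Λ₂ g − 1∕g² + (b₁∕β₀)·log(1∕(β₀g²)) → 0`** (`twoLoopScaling_of_typedTheorem2`).
# (β-flow team, prover 1, unit `b2b-balaban-beta-bflow-p1`, gen 40; ROW AP-I·Uc × NODE U2 × ROW Λ — carrier ENDs of parts 44–49)

HONEST FRAMING (page 1 of everything the β sub-cell writes): discharging `BetaPertH` makes Bałaban's UV stability UNCONDITIONAL — a
real constructive-QFT result; it is NOT the continuum limit and NOT the Clay problem.  HONEST DEPENDENCY (cell reorg 2026-08-19,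
verbatim): «continuum YM on T⁴ ⇐ BetaPertH ∧ nine spine estimates (0/9 proved); BetaPertH ⇐ (D1) ∧ (D4) ∧ CAP+tail; G-an2-4 gates
asym, D1 and NE2/3/4.»  THIS MODULE DISCHARGES NOTHING: it COMPOSES part 36's carrier plumbing (`reference_of_typedTheorem2`, `package_threshold_exists`, node U2's
`memoryProfile_betaInf`, part 32's `exists_valueAtZero ∕ rate_le_valueAtZero`, part 35's `relativeLambda_exists`) with parts 44–49 (`abs_dynAbel_sub_sub_chart_le`,
`abs_dynAbel_sub_chart_le`, `tendsto_sq_mul_dynAbel`, `abel_levy_eq_dynAbel`, `continuousRG_exists`, `tendsto_twoLoopScaling`) BY NAME — nothing restated, nothing new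
proved about Bałaban's β.  HYPOTHESES, NEVER FACTS: `Theorem2Statement` ([I] Thm 2 p. 259 — STATED WITHOUT PROOF in [I]; its proof is [I] §§1–5 + [12,13,17], NOT in the
tree), `ScaleShiftRate` (GAPS G-t4-U2-1), `HistLipschitz`∕`FadingMemory` (G-t4-U2-2) are LETTERS the planner's NE4 ∕ node-U2 items must discharge; the two-loop coordinate
in §78 is a HYPOTHESIS (no (T2m) letter is typed for Bałaban's β: Erice (3.73) is for the lattice functions, [I] p. 298).  NOT CLAIMED: that Bałaban's block-spin
transformations themselves form or embed in a continuous group — the semigroup acts on the continuum running COUPLING near zero pin only; `BetaPertH`; the continuum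
limit of gauge fields; Clay.  [I] = T. Bałaban, Commun. Math. Phys. **109** (1987) 249–301 [Balaban1987RG1].

WHAT THIS FILE PROVES (0 sorry, 0 def): §77 **`lambdaPrincipal_of_typedTheorem2`**, **`continuousRG_of_typedTheorem2`**; §78 **`twoLoopScaling_of_typedTheorem2`**.
-/

namespace Summit.QuantumFields.BalabanUV.Beta.EriceFlowEnclosureB12AsPrintedHistoryContagionShiftFlowZeroSemigroupEnd

open Finset Filter Topology Set Function
open Literature.MathematicalPhysics.QuantumFieldTheory.Balaban1983to89
open Literature.MathematicalPhysics.QuantumFieldTheory.Balaban1983to89.B12BetaAsPrinted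
open Literature.MathematicalPhysics.QuantumFieldTheory.Balaban1983to89.FlowStep (RGEqH HBeta)
open Literature.MathematicalPhysics.QuantumFieldTheory.Balaban1983to89.T4CouplingMatching (HistLipschitz FadingMemory ScaleShiftRate sprof)
open Literature.MathematicalPhysics.QuantumFieldTheory.Balaban1983to89.T4ContinuumCoupling (gstar)
open Literature.MathematicalPhysics.QuantumFieldTheory.Balaban1983to89.T4BetaStationary (SeqBox MemoryProfile betaInf memoryProfile_betaInf)
open Literature.MathematicalPhysics.QuantumFieldTheory.Balaban1983to89.T4BetaFlowWellPosed (MemFlow solution)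
open Summit.QuantumFields.BalabanUV.Beta.EriceFlowEnclosureB12AsPrintedHistoryContagionShiftFlowPicardEnd (reference_of_typedTheorem2)
open Summit.QuantumFields.BalabanUV.Beta.EriceFlowEnclosureB12AsPrintedHistoryContagionShiftFlowZero (exists_valueAtZero rate_le_valueAtZero)
open Summit.QuantumFields.BalabanUV.Beta.EriceFlowEnclosureB12AsPrintedHistoryContagionShiftFlowZeroLambda (relativeLambda_exists)
open Summit.QuantumFields.BalabanUV.Beta.EriceFlowEnclosureB12AsPrintedHistoryContagionShiftFlowZeroEnd (package_threshold_exists)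
open Summit.QuantumFields.BalabanUV.Beta.EriceFlowEnclosureB12AsPrintedHistoryContagionShiftFlowZeroIsometry (abs_dynAbel_sub_sub_chart_le abs_dynAbel_sub_chart_le
  tendsto_sq_mul_dynAbel)
open Summit.QuantumFields.BalabanUV.Beta.EriceFlowEnclosureB12AsPrintedHistoryContagionShiftFlowZeroPrincipal (abel_levy_eq_dynAbel)
open Summit.QuantumFields.BalabanUV.Beta.EriceFlowEnclosureB12AsPrintedHistoryContagionShiftFlowZeroSemigroup (continuousRG_exists)
open Summit.QuantumFields.BalabanUV.Beta.EriceFlowEnclosureB12AsPrintedHistoryContagionShiftFlowZeroIsometryTwoLoop (tendsto_twoLoopScaling)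

noncomputable section

variable {S : Setting}

/-! ## §77 Theorem 2 AS TYPED: the principal Λ-coordinate and the continuous renormalization group of the continuum running coupling -/

/-- **THE Λ-FUNCTION OF THE CONTINUUM TRAJECTORIES IS ASYMPTOTICALLY CHART-ISOMETRIC, OBEYS ONE-LOOP ASYMPTOTIC SCALING, AND IS THE PRINCIPAL ABEL FUNCTION — FROM THEOREM 2
AS TYPED.**  `Theorem2Statement S hL` (a HYPOTHESIS), `hrg` on ]0, γ_u], NE4 `ScaleShiftRate c θ γ_u S.β` (c ≥ 0), `HistLipschitz Λ γ_u S.β` with `FadingMemory C θ Λ` (0 < θ <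
1, C ≥ 0).  THEN there are β₀ > 0 (THE value of `betaInf S.β` at the zero history), b ∈ ]0, β₀] and, for every torus exponent m, g₂₅ > 0 such that for EVERY reference coupling
`g′ ≤ g₂₅` with a Theorem-2-type family `rows′` there is `Λf : ℝ → ℝ`, `Λf g′ = 0`, with: (conv+Abel) for every family `rows` pinned at `g ∈ ]0, g′]`,
`1∕gstar rows n² − 1∕gstar rows′ n² → Λf g` and `Λf (gstar rows k) = Λf g + kβ₀`; (ISOMETRY) **`|(Λf g − Λf g̃) − (1∕g² − 1∕g̃²)| ≤ (64C∕(3(1−θ)b))·g̃·(1∕g² − 1∕g̃²)`**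
for `0 < g ≤ g̃ ≤ g′`; (SCALING) **`|Λf g − (1∕g² − 1∕g′²)| ≤ (8C∕((1−θ)b))∕g + (64C∕(3(1−θ)b))·g′·(β₀ + Cγ_u∕(1−θ))`** on ]0, g′] and **`g²·Λf g → 1`**; (PRINCIPAL)
every Abel function Φ of the limit flow on ]0, g′] (`Φ(h k) = Φ e + kβ₀` along every box solution of `MemFlow (betaInf S.β)` from every pin) satisfying Lévy's criterion
is **`Φ = Λf + Φ g′`**. [cite: Balaban1987RG1, Thm 2 (0.31) p.259 with (0.20) p.256 and §5 p.298] -/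
theorem lambdaPrincipal_of_typedTheorem2 {hL : Odd S.L ∧ 1 < S.L} (h : Theorem2Statement S hL)
    {γu θ C c : ℝ} {Λ : ℕ → ℕ → ℝ} (hγu : 0 < γu)
    (hrg : ∀ P : B12.RunParams, Step.InInterval γu P.K (S.cpl P) → RGEqH P.K S.β (S.cpl P))
    (hS : ScaleShiftRate c θ γu S.β) (hL' : HistLipschitz Λ γu S.β) (hΛ : FadingMemory C θ Λ)
    (hθ0 : 0 < θ) (hθ1 : θ < 1) (hC : 0 ≤ C) (hc : 0 ≤ c) (m : ℕ) :
    ∃ β₀ b g₂₅ : ℝ, 0 < b ∧ b ≤ β₀ ∧ 0 < g₂₅ ∧ (∀ u : ℕ → ℝ, SeqBox γu u → |betaInf S.β u - β₀| ≤ C * ∑' j, θ ^ j * u j) ∧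
      ∀ (g' : ℝ) (rows' : ℕ → ℕ → ℝ), 0 < g' → g' ≤ g₂₅ →
      (∀ K, ∃ (m' : ℕ) (g₀ : ℝ), rows' K = S.cpl ⟨K, m', g₀⟩) → (∀ K, Step.InInterval γu K (rows' K)) → (∀ K, rows' K K = g') →
      ∃ Λf : ℝ → ℝ, Λf g' = 0 ∧
        (∀ (g : ℝ) (rows : ℕ → ℕ → ℝ), 0 < g → g ≤ g' →
          (∀ K, ∃ (m' : ℕ) (g₀ : ℝ), rows K = S.cpl ⟨K, m', g₀⟩) → (∀ K, Step.InInterval γu K (rows K)) → (∀ K, rows K K = g) →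
          Tendsto (fun n => 1 / (gstar rows n) ^ 2 - 1 / (gstar rows' n) ^ 2) atTop (𝓝 (Λf g)) ∧ ∀ k : ℕ, Λf (gstar rows k) = Λf g + (k : ℝ) * β₀) ∧
        (∀ g g'' : ℝ, 0 < g → g ≤ g'' → g'' ≤ g' →
          |(Λf g - Λf g'') - (1 / g ^ 2 - 1 / g'' ^ 2)| ≤ 64 * C / (3 * (1 - θ) * b) * g'' * (1 / g ^ 2 - 1 / g'' ^ 2)) ∧
        (∀ g : ℝ, 0 < g → g ≤ g' →
          |Λf g - (1 / g ^ 2 - 1 / g' ^ 2)| ≤ 8 * C / ((1 - θ) * b) * (1 / g) + 64 * C / (3 * (1 - θ) * b) * g' * (β₀ + C * γu / (1 - θ))) ∧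
        Tendsto (fun g : ℝ => g ^ 2 * Λf g) (𝓝[>] 0) (𝓝 1) ∧
        ∀ Φ : ℝ → ℝ,
          (∀ e ∈ Ioc (0 : ℝ) g', ∀ hh : ℕ → ℝ, SeqBox γu hh → MemFlow (betaInf S.β) e hh → ∀ k : ℕ, Φ (hh k) = Φ e + (k : ℝ) * β₀) →
          (∀ W ε : ℝ, 0 < ε → ∃ δ > 0, ∀ g g'' : ℝ, 0 < g → g ≤ g'' → g'' ≤ δ → g'' ≤ g' → 1 / g ^ 2 - 1 / g'' ^ 2 ≤ W →
            |(Φ g - Φ g'') - (1 / g ^ 2 - 1 / g'' ^ 2)| ≤ ε) →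
          ∀ g : ℝ, 0 < g → g ≤ g' → Φ g = Λf g + Φ g' := by
  have h1θ : 0 < 1 - θ := by linarith
  have hB := memoryProfile_betaInf hS hL' hΛ hθ0.le hθ1
  obtain ⟨β₀, h0⟩ := exists_valueAtZero hB hC hθ0.le hθ1 hγu
  obtain ⟨gr, b, g₂, -, t, hgr, hb, hg₂, -, htbox, htflow, hprof, hmem, -⟩ :=
    reference_of_typedTheorem2 h hγu hrg hS hL' hΛ hθ0 hθ1 hC hc m
  have h2gr : 0 < 2 * gr := by positivity
  have hbβ : b ≤ β₀ := rate_le_valueAtZero hC hθ0.le hθ1 hb h2gr h0 htbox htflow hprof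
  obtain ⟨e₀, he₀, hthr⟩ := package_threshold_exists (1 / gr ^ 2 + C * γu / (1 - θ) ^ 2 + (2 * C / ((1 - θ) * b)) ^ 2) hC hθ1 hb
  refine ⟨β₀, b, min e₀ (min g₂ (γu / 2)), hb, hbβ, lt_min he₀ (lt_min hg₂ (by positivity)), h0, fun g' rows' hg' hle hrow' hI' hpin' => ?_⟩
  obtain ⟨hs1, hs2, hs4, hs5⟩ := hthr g' hg' (hle.trans (min_le_left _ _))
  have hle2' : g' ≤ g₂ := hle.trans ((min_le_right _ _).trans (min_le_left _ _))
  have h2g' : 2 * g' ≤ γu := by linarith [hle.trans ((min_le_right _ _).trans (min_le_right _ _))]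
  obtain ⟨hbox', hflow'⟩ := hmem rows' g' hrow' hI' hpin' hle2'
  obtain ⟨Λf, hΛ0, hΛh, -, -, -, habel, -⟩ :=
    relativeLambda_exists hB hC hθ0.le hθ1 hb h2gr h0 htbox htflow hprof hg' h2g' hs1 hs2 hs4 hs5 hbox' hflow'
  -- Λf is a dynamical Abel function with comparison sequence 1∕gstar rows′²
  have hdyn : ∀ e ∈ Ioc (0 : ℝ) g', ∀ hh : ℕ → ℝ, SeqBox γu hh → MemFlow (betaInf S.β) e hh →
      Tendsto (fun n => 1 / hh n ^ 2 - 1 / (gstar rows' n) ^ 2) atTop (𝓝 (Λf e)) := hΛh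
  have hsc := tendsto_sq_mul_dynAbel hB hC hθ0.le hθ1 hb h2gr h0 htbox htflow hprof hdyn hg' h2g' hs1 hs2 hs4 hs5 hbox' hflow'
  rw [hΛ0] at hsc
  simp only [sub_zero] at hsc
  refine ⟨Λf, hΛ0, fun g rows hg hgg' hrow hI hpin => ?_, fun g g'' hg hgg'' hg''le =>
    abs_dynAbel_sub_sub_chart_le hB hC hθ0.le hθ1 hb h2gr htbox htflow hprof hdyn h2g' hs1 hs2 hs4 hs5 hg hgg'' hg''le, fun g hg hgle => ?_, hsc,
    fun Φ hΦ hLΦ g hg hgle => ?_⟩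
  · obtain ⟨hbox, hflow⟩ := hmem rows g hrow hI hpin (hgg'.trans hle2')
    exact ⟨hΛh g ⟨hg, hgg'⟩ _ hbox hflow, habel g ⟨hg, hgg'⟩ _ hbox hflow⟩
  · have := abs_dynAbel_sub_chart_le hB hC hθ0.le hθ1 hb h2gr h0 htbox htflow hprof hdyn hg' h2g' hs1 hs2 hs4 hs5 hbox' hflow' hg hgle
    rw [hΛ0] at this
    simpa only [sub_zero] using this
  · have := abel_levy_eq_dynAbel hB hC hθ0.le hθ1 hb h2gr h0 htbox htflow hprof hdyn hg' h2g' hs1 hs2 hs4 hs5 hbox' hflow' hΦ hLΦ hg hgle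
    rw [hΛ0, sub_zero] at this
    exact this

/-- **THE CONTINUUM RUNNING COUPLING OF [I] THEOREM 2 EMBEDS IN A CANONICAL CONTINUOUS RENORMALIZATION GROUP — FROM THEOREM 2 AS TYPED.**  Under the data of
`lambdaPrincipal_of_typedTheorem2` there are β₀ > 0 and, for every torus exponent m, g₂₅ > 0 such that for EVERY reference coupling `g′ ≤ g₂₅` with a Theorem-2-type family
there is a two-parameter family `φ : ℝ → ℝ → ℝ` — a ONE-PARAMETER SEMIGROUP on ]0, g′] for `s ≥ 0` (`φ s g ∈ ]0, g′]`, `φ 0 g = g`, **`φ (s+s′) g = φ s (φ s′ g)`**) — with: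
(orbits) **`φ k g = gstar rows k`** for EVERY family `rows` of Theorem-2-type rows pinned at `g ∈ ]0, g′]` and every physical scale k — the continuum running coupling of
«g₀(ε, g)» IS the integer-time orbit, `φ 1` the continuum renormalization step, `φ (1∕2) (φ (1∕2) g) = φ 1 g` HALF A STEP; (order) each `φ s` strictly increasing, `s ↦ φ s g`
strictly decreasing; (rates) `(3∕4)β₀(s′ − s) ≤ 1∕φ s′ g² − 1∕φ s g² ≤ (3∕2)β₀(s′ − s)`; (UV) `φ s g → 0` and THE CONTINUOUS CLOCK **`s·β₀·(φ s g)² → 1`**.  By part 47 the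
semigroup is the same for every principal Abel function (canonical). [cite: Balaban1987RG1, Thm 2 (0.31) p.259 with (0.20) p.256 and §5 p.298] -/
theorem continuousRG_of_typedTheorem2 {hL : Odd S.L ∧ 1 < S.L} (h : Theorem2Statement S hL)
    {γu θ C c : ℝ} {Λ : ℕ → ℕ → ℝ} (hγu : 0 < γu)
    (hrg : ∀ P : B12.RunParams, Step.InInterval γu P.K (S.cpl P) → RGEqH P.K S.β (S.cpl P))
    (hS : ScaleShiftRate c θ γu S.β) (hL' : HistLipschitz Λ γu S.β) (hΛ : FadingMemory C θ Λ)
    (hθ0 : 0 < θ) (hθ1 : θ < 1) (hC : 0 ≤ C) (hc : 0 ≤ c) (m : ℕ) :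
    ∃ β₀ g₂₅ : ℝ, 0 < β₀ ∧ 0 < g₂₅ ∧ (∀ u : ℕ → ℝ, SeqBox γu u → |betaInf S.β u - β₀| ≤ C * ∑' j, θ ^ j * u j) ∧
      ∀ (g' : ℝ) (rows' : ℕ → ℕ → ℝ), 0 < g' → g' ≤ g₂₅ →
      (∀ K, ∃ (m' : ℕ) (g₀ : ℝ), rows' K = S.cpl ⟨K, m', g₀⟩) → (∀ K, Step.InInterval γu K (rows' K)) → (∀ K, rows' K K = g') →
      ∃ φ : ℝ → ℝ → ℝ,
        (∀ s : ℝ, 0 ≤ s → ∀ g ∈ Ioc (0 : ℝ) g', φ s g ∈ Ioc (0 : ℝ) g') ∧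
        (∀ g ∈ Ioc (0 : ℝ) g', φ 0 g = g) ∧
        (∀ s s' : ℝ, 0 ≤ s → 0 ≤ s' → ∀ g ∈ Ioc (0 : ℝ) g', φ (s + s') g = φ s (φ s' g)) ∧
        (∀ (g : ℝ) (rows : ℕ → ℕ → ℝ), 0 < g → g ≤ g' →
          (∀ K, ∃ (m' : ℕ) (g₀ : ℝ), rows K = S.cpl ⟨K, m', g₀⟩) → (∀ K, Step.InInterval γu K (rows K)) → (∀ K, rows K K = g) →
          ∀ k : ℕ, φ k g = gstar rows k) ∧
        (∀ g ∈ Ioc (0 : ℝ) g', φ (1 / 2) (φ (1 / 2) g) = φ 1 g) ∧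
        (∀ s : ℝ, 0 ≤ s → StrictMonoOn (φ s) (Ioc 0 g')) ∧
        (∀ g ∈ Ioc (0 : ℝ) g', ∀ s s' : ℝ, 0 ≤ s → s < s' → φ s' g < φ s g) ∧
        (∀ g ∈ Ioc (0 : ℝ) g', ∀ s s' : ℝ, 0 ≤ s → s ≤ s' →
          3 / 4 * β₀ * (s' - s) ≤ 1 / φ s' g ^ 2 - 1 / φ s g ^ 2 ∧ 1 / φ s' g ^ 2 - 1 / φ s g ^ 2 ≤ 3 / 2 * β₀ * (s' - s)) ∧
        (∀ g ∈ Ioc (0 : ℝ) g', Tendsto (fun s : ℝ => φ s g) atTop (𝓝 0)) ∧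
        (∀ g ∈ Ioc (0 : ℝ) g', Tendsto (fun s : ℝ => s * β₀ * φ s g ^ 2) atTop (𝓝 1)) := by
  have h1θ : 0 < 1 - θ := by linarith
  have hB := memoryProfile_betaInf hS hL' hΛ hθ0.le hθ1
  obtain ⟨β₀, h0⟩ := exists_valueAtZero hB hC hθ0.le hθ1 hγu
  obtain ⟨gr, b, g₂, -, t, hgr, hb, hg₂, -, htbox, htflow, hprof, hmem, -⟩ :=
    reference_of_typedTheorem2 h hγu hrg hS hL' hΛ hθ0 hθ1 hC hc m
  have h2gr : 0 < 2 * gr := by positivity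
  have hβ₀ : 0 < β₀ := hb.trans_le (rate_le_valueAtZero hC hθ0.le hθ1 hb h2gr h0 htbox htflow hprof)
  obtain ⟨e₀, he₀, hthr⟩ := package_threshold_exists (1 / gr ^ 2 + C * γu / (1 - θ) ^ 2 + (2 * C / ((1 - θ) * b)) ^ 2) hC hθ1 hb
  refine ⟨β₀, min e₀ (min g₂ (γu / 2)), hβ₀, lt_min he₀ (lt_min hg₂ (by positivity)), h0, fun g' rows' hg' hle hrow' hI' hpin' => ?_⟩
  obtain ⟨hs1, hs2, hs4, hs5⟩ := hthr g' hg' (hle.trans (min_le_left _ _))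
  have hle2' : g' ≤ g₂ := hle.trans ((min_le_right _ _).trans (min_le_left _ _))
  have h2g' : 2 * g' ≤ γu := by linarith [hle.trans ((min_le_right _ _).trans (min_le_right _ _))]
  obtain ⟨hbox', hflow'⟩ := hmem rows' g' hrow' hI' hpin' hle2'
  obtain ⟨φ, hmemφ, hzero, hadd, horb, hhalf, hmono, hanti, hrates, hlim, hclock⟩ :=
    continuousRG_exists hB hC hθ0.le hθ1 hb h2gr h0 htbox htflow hprof hg' h2g' hs1 hs2 hs4 hs5 hbox' hflow'
  refine ⟨φ, hmemφ, hzero, hadd, fun g rows hg hgg' hrow hI hpin k => ?_, hhalf, hmono, hanti, hrates, hlim, hclock⟩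
  obtain ⟨hbox, hflow⟩ := hmem rows g hrow hI hpin (hgg'.trans hle2')
  exact horb g ⟨hg, hgg'⟩ _ hbox hflow k

/-! ## §78 Theorem 2 AS TYPED + a two-loop coordinate of the limit flow: two-loop asymptotic scaling -/

/-- **TWO-LOOP ASYMPTOTIC SCALING ON THE CARRIER.**  Under the data of `lambdaPrincipal_of_typedTheorem2` there are β₀ > 0 and, for every torus exponent m, g₂₅ > 0 such that
for every reference coupling `g′ ≤ g₂₅` with a Theorem-2-type family and EVERY two-loop coordinate Λ₂ of the limit flow on ]0, g′] — a dynamical Abel function with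
`1∕h(n)² − nβ₀ − (b₁∕β₀) log n → Λ₂ e` along every box solution of `MemFlow (betaInf S.β)` from every pin `e ∈ ]0, g′]` (part 41 produces one under the two-loop letter with
memory (T2m) for `betaInf S.β` — a HYPOTHESIS, not typed for Bałaban's β) —: **`Λ₂ g − 1∕g² + (b₁∕β₀)·log(1∕(β₀g²)) → 0` as `g → 0⁺`**.
[cite: Balaban1987RG1, Thm 2 (0.31) p.259 with (0.20) p.256 and §5 p.298] -/
theorem twoLoopScaling_of_typedTheorem2 {hL : Odd S.L ∧ 1 < S.L} (h : Theorem2Statement S hL)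
    {γu θ C c : ℝ} {Λ : ℕ → ℕ → ℝ} (hγu : 0 < γu)
    (hrg : ∀ P : B12.RunParams, Step.InInterval γu P.K (S.cpl P) → RGEqH P.K S.β (S.cpl P))
    (hS : ScaleShiftRate c θ γu S.β) (hL' : HistLipschitz Λ γu S.β) (hΛ : FadingMemory C θ Λ)
    (hθ0 : 0 < θ) (hθ1 : θ < 1) (hC : 0 ≤ C) (hc : 0 ≤ c) (m : ℕ) :
    ∃ β₀ g₂₅ : ℝ, 0 < β₀ ∧ 0 < g₂₅ ∧ (∀ u : ℕ → ℝ, SeqBox γu u → |betaInf S.β u - β₀| ≤ C * ∑' j, θ ^ j * u j) ∧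
      ∀ (g' : ℝ) (rows' : ℕ → ℕ → ℝ), 0 < g' → g' ≤ g₂₅ →
      (∀ K, ∃ (m' : ℕ) (g₀ : ℝ), rows' K = S.cpl ⟨K, m', g₀⟩) → (∀ K, Step.InInterval γu K (rows' K)) → (∀ K, rows' K K = g') →
      ∀ (b₁ : ℝ) (Λ₂ : ℝ → ℝ),
        (∀ e ∈ Ioc (0 : ℝ) g', ∀ hh : ℕ → ℝ, SeqBox γu hh → MemFlow (betaInf S.β) e hh →
          Tendsto (fun n => 1 / hh n ^ 2 - ((n : ℝ) * β₀ + b₁ / β₀ * Real.log (n : ℝ))) atTop (𝓝 (Λ₂ e))) →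
        Tendsto (fun g : ℝ => Λ₂ g - 1 / g ^ 2 + b₁ / β₀ * Real.log (1 / (β₀ * g ^ 2))) (𝓝[>] 0) (𝓝 0) := by
  have h1θ : 0 < 1 - θ := by linarith
  have hB := memoryProfile_betaInf hS hL' hΛ hθ0.le hθ1
  obtain ⟨β₀, h0⟩ := exists_valueAtZero hB hC hθ0.le hθ1 hγu
  obtain ⟨gr, b, g₂, -, t, hgr, hb, hg₂, -, htbox, htflow, hprof, hmem, -⟩ :=
    reference_of_typedTheorem2 h hγu hrg hS hL' hΛ hθ0 hθ1 hC hc m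
  have h2gr : 0 < 2 * gr := by positivity
  have hβ₀ : 0 < β₀ := hb.trans_le (rate_le_valueAtZero hC hθ0.le hθ1 hb h2gr h0 htbox htflow hprof)
  obtain ⟨e₀, he₀, hthr⟩ := package_threshold_exists (1 / gr ^ 2 + C * γu / (1 - θ) ^ 2 + (2 * C / ((1 - θ) * b)) ^ 2) hC hθ1 hb
  refine ⟨β₀, min e₀ (min g₂ (γu / 2)), hβ₀, lt_min he₀ (lt_min hg₂ (by positivity)), h0, fun g' rows' hg' hle hrow' hI' hpin' b₁ Λ₂ hΛ₂ => ?_⟩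
  obtain ⟨hs1, hs2, hs4, hs5⟩ := hthr g' hg' (hle.trans (min_le_left _ _))
  have hle2' : g' ≤ g₂ := hle.trans ((min_le_right _ _).trans (min_le_left _ _))
  have h2g' : 2 * g' ≤ γu := by linarith [hle.trans ((min_le_right _ _).trans (min_le_right _ _))]
  obtain ⟨hbox', hflow'⟩ := hmem rows' g' hrow' hI' hpin' hle2'
  exact tendsto_twoLoopScaling hB hC hθ0.le hθ1 hb h2gr h0 htbox htflow hprof hΛ₂ hg' h2g' hs1 hs2 hs4 hs5 hbox' hflow'

end

end Summit.QuantumFields.BalabanUV.Beta.EriceFlowEnclosureB12AsPrintedHistoryContagionShiftFlowZeroSemigroupEnd
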